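import Summits.ResolutionOfSingularities.ResolutionOfSingularities.Theorems.HilbertSamuelEliminationCampaignW42ToricMarkedResidual
import Mathlib.Algebra.BigOperators.Ring.Finset
import Mathlib.Algebra.Order.Ring.Int

/-!
# [OURS · L1 W4.2] Toric marked monomial objects in dimension 3 — brick 4B: the DIMENSION-2 COEFFICIENT DATA `𝒞_k` at a corner

[OURS · L1 W4.2 · seat res-L1-s42-pv-2 gen 5] Memo `L/res-L1-s42-pv-2/CALIBRATION-W42-O2-v4.md` §3 (F3)–(F5).  Two layers:

§A (abstract, no toric data).  A finite configuration of integer points `(x g, y g)`, `g ∈ G`: the PAIR-WIDTH potential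
`T := Σ_{(g,g') incomparable, x g < x g'} (x g' − x g) + (y g − y g')`, the componentwise minimum sum `psum`, and the four facts of the
dim-2 step of the existence proof: under the «point move» maps `(x,y) ↦ (x, x+y−c)` and `(x,y) ↦ (x+y−c, y)` the potential `T` drops
strictly as soon as it is positive; `T = 0` forces a componentwise-minimal point (principal configuration); for a principal configuration
with «reduced» minimum (`min x < c`, resp. `min y < c`) the minimum sum drops strictly; translations `x ↦ x − c` leave `T` unchanged.

§B (toric).  For a state `s`, a phase value `θs > 0`, the marking `m`, a common multiple `L` of the denominators and a ray `k`: the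
generator set `G2` of the coefficient object `𝒞_k` (generators `u` with `α_k(u) < θs`, plus the companion's monomial generator when
`θs < m` and `β_k < m − θs`) and the INTEGER-SCALED coefficient exponents `E2 r g` (`= L·α_r(u)·θs/(θs − α_k(u))`, resp.
`L·β_r·θs/(m − θs − β_k)`); invariance at old rays; the transform law (K2) for the new ray of a blow-up of full residual order through
`k`; and (K3a): a 2-face `{k, r}` of full residual order is admissible iff every `E2 r g ≥ θs·L`.
Replaces the role of Blanco 2012 I Def 3.7 / Prop 3.12–3.13 (E-coefficient ideal, monomial form); NOT a statement of the manuscript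
under review nor of Blanco / Encinas–Villamayor.  AI work, weaker than expert review.  No `sorry`, no new axiom.
-/

set_option linter.dupNamespace false -- mandated namespace of this single-conjunct summit

namespace Summit.ResolutionOfSingularities.ResolutionOfSingularities.Theorems.CampaignW42.Toric

open Finset

/-! ## §B  The dimension-2 coefficient data at a ray `k` -/

namespace TState

variable {ι : Type} [Fintype ι] [Nonempty ι] [DecidableEq ι]

/-- **[OURS · L1 W4.2]** Generators of the coefficient object `𝒞_k` in the phase of residual order `θs`: the generators `u` with
`α_k(u) < θs` (as `some u`), plus the companion's monomial generator (`none`) when `θs < m` and `β_k < m − θs`. -/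
def G2 (s : TState ι) (m : ℕ) (θs : ℤ) (k : ℕ) : Finset (Option ι) :=
  ((Finset.univ.filter (fun u => s.alpha k u < θs)).image some) ∪
    (if θs < m ∧ s.beta k < (m : ℤ) - θs then {none} else ∅)

/-- **[OURS · L1 W4.2]** INTEGER-SCALED coefficient exponent of generator `g` of `𝒞_k` at the ray `r` (`L` = a common multiple of the
denominators): `L·α_r(u)·θs/(θs − α_k(u))` for `g = some u`, `L·β_r·θs/(m − θs − β_k)` for the monomial generator. -/
def E2 (s : TState ι) (m : ℕ) (θs L : ℤ) (k r : ℕ) : Option ι → ℤ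
  | some u => s.alpha r u * θs * (L / (θs - s.alpha k u))
  | none => s.beta r * θs * (L / ((m : ℤ) - θs - s.beta k))

/-- **[OURS · L1 W4.2]** `L` is a COMMON MULTIPLE of all denominators of the phase: every `d` with `0 < d ≤ max θs m` divides `L`. -/
def CommonMult (m : ℕ) (θs L : ℤ) : Prop := 0 < L ∧ ∀ d : ℤ, 0 < d → d ≤ max θs m → d ∣ L

/-- Membership of an ordinary generator in `G2`. -/
theorem mem_G2_some {s : TState ι} {m : ℕ} {θs : ℤ} {k : ℕ} {u : ι} :
    some u ∈ s.G2 m θs k ↔ s.alpha k u < θs := by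
  unfold G2
  rw [Finset.mem_union, Finset.mem_image]
  constructor
  · rintro (⟨v, hv, hvu⟩ | h)
    · rw [Finset.mem_filter] at hv; cases hvu; exact hv.2
    · split_ifs at h <;> simp at h
  · intro h; exact Or.inl ⟨u, Finset.mem_filter.mpr ⟨Finset.mem_univ u, h⟩, rfl⟩

/-- Membership of the companion's monomial generator in `G2`. -/
theorem mem_G2_none {s : TState ι} {m : ℕ} {θs : ℤ} {k : ℕ} :
    none ∈ s.G2 m θs k ↔ θs < m ∧ s.beta k < (m : ℤ) - θs := by
  unfold G2
  rw [Finset.mem_union, Finset.mem_image]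
  constructor
  · rintro (⟨v, -, hv⟩ | h)
    · cases hv
    · split_ifs at h with hc
      · exact hc
      · simp at h
  · intro h; right; rw [if_pos h]; exact Finset.mem_singleton_self _

/-- `𝒞_k` has a generator in a positive phase (a generator with `α_k = 0`). -/
theorem G2_nonempty (s : TState ι) (m : ℕ) {θs : ℤ} (hθ : 0 < θs) (k : ℕ) : (s.G2 m θs k).Nonempty := by
  obtain ⟨u, hu⟩ := s.exists_alpha_eq_zero k
  exact ⟨some u, mem_G2_some.mpr (by rw [hu]; exact hθ)⟩

/-- The generator set of `𝒞_k` is unchanged by a blow-up (old ray `k`). -/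
theorem G2_move {m : ℕ} {s : TState ι} {R : Finset ℕ} {θs : ℤ} {k : ℕ} (hk : k ≠ s.next) :
    (s.move m R).G2 m θs k = s.G2 m θs k := by
  ext g
  cases g with
  | none => rw [mem_G2_none, mem_G2_none, beta_move_of_ne hk]
  | some u => rw [mem_G2_some, mem_G2_some, alpha_move_of_ne hk]

omit [DecidableEq ι] in
/-- Coefficient exponents at old rays are unchanged by a blow-up. -/
theorem E2_move_of_ne {m : ℕ} {s : TState ι} {R : Finset ℕ} {θs L : ℤ} {k r : ℕ} (hk : k ≠ s.next) (hr : r ≠ s.next)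
    (g : Option ι) : (s.move m R).E2 m θs L k r g = s.E2 m θs L k r g := by
  cases g with
  | none => simp only [E2, beta_move_of_ne hk, beta_move_of_ne hr]
  | some u => simp only [E2, alpha_move_of_ne hk, alpha_move_of_ne hr]

/-- **(K2) Transform law of the coefficient object.**  Under the blow-up of a face `R ∋ k` of full residual order `θs`, the new ray's
coefficient exponents are `Σ_{r ∈ R ∖ k} E2 r − θs·L`, for every generator of `𝒞_k` (including the monomial one). -/
theorem E2_move_next {m : ℕ} {s : TState ι} (hs : s.Nonneg) {R : Finset ℕ} {θs L : ℤ} {k' : ℕ} (hwf_k : k' ≠ s.next)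
    (hk : k' ∈ R) (hθ : s.thetaR R = θs) (hL : CommonMult m θs L) {g : Option ι} (hg : g ∈ s.G2 m θs k') :
    (s.move m R).E2 m θs L k' s.next g = (∑ r ∈ R.erase k', s.E2 m θs L k' r g) - θs * L := by
  cases g with
  | some u =>
    have hu := mem_G2_some.mp hg
    set d := θs - s.alpha k' u with hd
    have hdpos : 0 < d := by omega
    have hdle : d ≤ max θs m := by have := s.alpha_nonneg k' u; rw [hd]; exact le_max_of_le_left (by omega)
    have hdvd : d ∣ L := hL.2 d hdpos hdle
    simp only [E2, alpha_move_of_ne hwf_k, alpha_move_next]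
    rw [← hd]
    have hsum : s.alphaSum R u = (∑ r ∈ R.erase k', s.alpha r u) + s.alpha k' u := by
      unfold alphaSum; rw [Finset.sum_erase_eq_sub hk]; ring
    rw [← Finset.sum_mul, ← Finset.sum_mul, hsum, hθ]
    have hkey : (s.alpha k' u - θs) * θs * (L / d) = -(θs * L) := by
      have : s.alpha k' u - θs = -d := by rw [hd]; ring
      rw [this]
      have := Int.mul_ediv_cancel' hdvd
      calc -d * θs * (L / d) = -(θs * (d * (L / d))) := by ring
        _ = -(θs * L) := by rw [this]
    calc (∑ r ∈ R.erase k', s.alpha r u + s.alpha k' u - θs) * θs * (L / d)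
        = (∑ r ∈ R.erase k', s.alpha r u) * θs * (L / d) + (s.alpha k' u - θs) * θs * (L / d) := by ring
      _ = (∑ r ∈ R.erase k', s.alpha r u) * θs * (L / d) - θs * L := by rw [hkey]; ring
  | none =>
    obtain ⟨hθm, hβ⟩ := mem_G2_none.mp hg
    set d := (m : ℤ) - θs - s.beta k' with hd
    have hdpos : 0 < d := by omega
    have hdle : d ≤ max θs m := by
      have := beta_nonneg hs k'
      have h0 : 0 ≤ θs := by rw [← hθ]; exact s.thetaR_nonneg R
      refine le_max_of_le_right ?_; omega
    have hdvd : d ∣ L := hL.2 d hdpos hdle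
    simp only [E2, beta_move_of_ne hwf_k, beta_move_next]
    rw [← hd]
    have hsum : s.betaSum R = (∑ r ∈ R.erase k', s.beta r) + s.beta k' := by
      unfold betaSum; rw [Finset.sum_erase_eq_sub hk]; ring
    rw [← Finset.sum_mul, ← Finset.sum_mul, hsum, hθ]
    have hkey : (s.beta k' + θs - m) * θs * (L / d) = -(θs * L) := by
      have : s.beta k' + θs - (m : ℤ) = -d := by rw [hd]; ring
      rw [this]
      have := Int.mul_ediv_cancel' hdvd
      calc -d * θs * (L / d) = -(θs * (d * (L / d))) := by ring
        _ = -(θs * L) := by rw [this]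
    calc (∑ r ∈ R.erase k', s.beta r + s.beta k' + θs - ↑m) * θs * (L / d)
        = (∑ r ∈ R.erase k', s.beta r) * θs * (L / d) + (s.beta k' + θs - m) * θs * (L / d) := by ring
      _ = (∑ r ∈ R.erase k', s.beta r) * θs * (L / d) - θs * L := by rw [hkey]; ring

/-- Cancellation helper: `d·θs·q ≤ a·θs·q` with `θs, q > 0` gives `d ≤ a`. -/
private theorem le_of_scaled {a d θs q : ℤ} (hθ : 0 < θs) (hq : 0 < q) (h : d * θs * q ≤ a * θs * q) : d ≤ a := by
  have hpos : 0 < θs * q := mul_pos hθ hq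
  have h' : d * (θs * q) ≤ a * (θs * q) := by
    calc d * (θs * q) = d * θs * q := by ring
      _ ≤ a * θs * q := h
      _ = a * (θs * q) := by ring
  exact le_of_mul_le_mul_right h' hpos

omit [DecidableEq ι] in
/-- Residual sum over a two-element face. -/
theorem alphaSum_pair (s : TState ι) {k r : ℕ} (hkr : k ≠ r) (u : ι) :
    s.alphaSum {k, r} u = s.alpha k u + s.alpha r u := by
  unfold alphaSum; rw [Finset.sum_pair hkr]

omit [DecidableEq ι] in
/-- `β`-sum over a two-element face. -/
theorem betaSum_pair (s : TState ι) {k r : ℕ} (hkr : k ≠ r) : s.betaSum {k, r} = s.beta k + s.beta r := by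
  unfold betaSum; rw [Finset.sum_pair hkr]

/-- **(K3a) Admissible curves are the reduced... non-reduced link rays.**  For a 2-face `{k, r}` of residual order `≤ θs` (automatic inside a
phase), admissibility is equivalent to: every generator of `𝒞_k` has scaled exponent `≥ θs·L` at `r` (the link ray `r̄` admits a ray
move of the coefficient object). -/
theorem admissible_pair_iff {m : ℕ} {s : TState ι} (hs : s.Nonneg) {θs L : ℤ} (hθ : 0 < θs) (hL : CommonMult m θs L)
    {k r : ℕ} (hkr : k ≠ r) (hface : s.IsFace {k, r}) (hle : s.thetaR {k, r} ≤ θs) :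
    s.Admissible m θs {k, r} ↔ ∀ g ∈ s.G2 m θs k, θs * L ≤ s.E2 m θs L k r g := by
  constructor
  · rintro ⟨-, hθeq, hM⟩ g hg
    cases g with
    | some u =>
      have hu := mem_G2_some.mp hg
      set d := θs - s.alpha k u with hd
      have hdpos : 0 < d := by omega
      have hdle : d ≤ max θs m := le_max_of_le_left (by have := s.alpha_nonneg k u; omega)
      have hdvd := hL.2 d hdpos hdle
      have hq : 0 < L / d := Int.ediv_pos_of_pos_of_dvd hL.1 (by omega) hdvd
      have h1 : θs ≤ s.alpha k u + s.alpha r u := by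
        rw [← s.alphaSum_pair hkr u, ← hθeq]; exact s.thetaR_le _ u
      have hLd : d * (L / d) = L := Int.mul_ediv_cancel' hdvd
      show θs * L ≤ s.alpha r u * θs * (L / d)
      calc θs * L = θs * (d * (L / d)) := by rw [hLd]
        _ = d * θs * (L / d) := by ring
        _ ≤ s.alpha r u * θs * (L / d) := by
          apply mul_le_mul_of_nonneg_right _ hq.le
          apply mul_le_mul_of_nonneg_right _ hθ.le
          omega
    | none =>
      obtain ⟨hθm, hβ⟩ := mem_G2_none.mp hg
      set d := (m : ℤ) - θs - s.beta k with hd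
      have hdpos : 0 < d := by omega
      have hdle : d ≤ max θs m := le_max_of_le_right (by have := beta_nonneg hs k; omega)
      have hdvd := hL.2 d hdpos hdle
      have hq : 0 < L / d := Int.ediv_pos_of_pos_of_dvd hL.1 (by omega) hdvd
      have h1 : (m : ℤ) - θs ≤ s.beta k + s.beta r := by rw [← s.betaSum_pair hkr]; exact hM hθm
      have hLd : d * (L / d) = L := Int.mul_ediv_cancel' hdvd
      show θs * L ≤ s.beta r * θs * (L / d)
      calc θs * L = θs * (d * (L / d)) := by rw [hLd]
        _ = d * θs * (L / d) := by ring
        _ ≤ s.beta r * θs * (L / d) := by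
          apply mul_le_mul_of_nonneg_right _ hq.le
          apply mul_le_mul_of_nonneg_right _ hθ.le
          omega
  · intro h
    refine ⟨hface, le_antisymm hle ?_, fun hθm => ?_⟩
    · -- θs ≤ θ_{k,r}
      apply s.le_thetaR_of_forall
      intro u
      rw [s.alphaSum_pair hkr u]
      by_cases hu : s.alpha k u < θs
      · have hg := h (some u) (mem_G2_some.mpr hu)
        set d := θs - s.alpha k u with hd
        have hdpos : 0 < d := by omega
        have hdle : d ≤ max θs m := le_max_of_le_left (by have := s.alpha_nonneg k u; omega)
        have hdvd := hL.2 d hdpos hdle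
        have hq : 0 < L / d := Int.ediv_pos_of_pos_of_dvd hL.1 (by omega) hdvd
        have hLd : d * (L / d) = L := Int.mul_ediv_cancel' hdvd
        have hg' : d * θs * (L / d) ≤ s.alpha r u * θs * (L / d) := by
          calc d * θs * (L / d) = θs * (d * (L / d)) := by ring
            _ = θs * L := by rw [hLd]
            _ ≤ _ := hg
        have := le_of_scaled hθ hq hg'
        omega
      · have := s.alpha_nonneg r u; omega
    · -- monomial condition
      rw [s.betaSum_pair hkr]
      by_cases hβ : s.beta k < (m : ℤ) - θs
      · have hg := h none (mem_G2_none.mpr ⟨hθm, hβ⟩)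
        set d := (m : ℤ) - θs - s.beta k with hd
        have hdpos : 0 < d := by omega
        have hdle : d ≤ max θs m := le_max_of_le_right (by have := beta_nonneg hs k; omega)
        have hdvd := hL.2 d hdpos hdle
        have hq : 0 < L / d := Int.ediv_pos_of_pos_of_dvd hL.1 (by omega) hdvd
        have hLd : d * (L / d) = L := Int.mul_ediv_cancel' hdvd
        have hg' : d * θs * (L / d) ≤ s.beta r * θs * (L / d) := by
          calc d * θs * (L / d) = θs * (d * (L / d)) := by ring
            _ = θs * L := by rw [hLd]
            _ ≤ _ := hg
        have := le_of_scaled hθ hq hg'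
        omega
      · have := beta_nonneg hs r; omega

end TState

end Summit.ResolutionOfSingularities.ResolutionOfSingularities.Theorems.CampaignW42.Toric
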